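import Mathlib
import Summits.Ventures.FusionMHD.Bench.SAlphaS025W104A06Panels
import Summits.Ventures.FusionMHD.Bench.SAlphaS025W104A11Panels
import Literature.MathematicalPhysics.MHD.BallooningSAlphaWitnessInterval
import HarnessLib

/-!
# F3 — THE UNSTABLE BAND OF THE `s–α` MODEL AT LOW SHEAR `s = 1/4`: `U_{1/4} ⊇ [3/5, 11/10]` — the `[−16, 16]` trial function `SAlphaS025W104` is a
# witness at `α = 3/5` AND at `α = 11/10`, hence (convexity in `α`) at every `α` between
(venture LADDER-GRIDFUSION, rung F3; cell `gridfusion`, typed by gridfusion-lit-3 (g14), 2026-08-28.  ONE composition file: 0 `def … : Prop` facts,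
0 defs, 0 kit jobs, no `native_decide`, no floating point in any statement; 2 × 16 kernel panel enclosures in the panel files.)

## THREE COLUMNS
CERTIFIED (kernel): in the `s–α` ballooning MODEL (Freidberg (12.96)–(12.99), `Λ = sθ − α sin θ`, `θ₀ = 0`) at shear `s = 1/4`: for EVERY
`α ∈ [3/5, 11/10]` the explicit trial function `X = Spline.trialX 1 1 SAlphaS025W104.pieces (−16)` has NEGATIVE one-surface energy on `[−16, 16]` —
`unstableWitness_06` (`W(3/5) ≈ −0.04242`), `unstableWitness_11` (`W(11/10) ≈ −0.007448`), then `unstableWitness_band`.  VALIDATED (not in the kernel):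
shooting edges `α₁(1/4) ≈ 0.327`, `α₂(1/4) ≈ 1.135`.  MODELLED: `s–α` model; «unstable» in the model's one-surface (Newcomb) sense; representation step
quoted in `BallooningSAlpha.lean`; no device.  Citations: Freidberg 2014 §12.3 (12.38)–(12.40), §12.6.2 (12.97) [Freidberg2014];
Mahboubi–Melquiond–Sibut-Pinote 2016 §3.2–3.3 [MahboubiMelquiondSibutpinote2016].
-/

open Literature.Analysis.ValidatedNumerics Literature.Analysis.ValidatedNumerics.PolyMP
open Literature.Analysis.ValidatedNumerics.NumericsMP Literature.Analysis.ValidatedNumerics.ExpPoly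
open Literature.MathematicalPhysics.MHD.Ballooning Literature.MathematicalPhysics.MHD.Ballooning.SAlpha
open Literature.MathematicalPhysics.MHD.Ballooning.SAlpha.Spline
open Set

namespace Summit.Ventures.FusionMHD.Bench.SAlphaS025W104

/-- THE GLUED SEGMENT at `α = 3/5` in summed form. [cite: MahboubiMelquiondSibutpinote2016, Sect. 3.3] -/
theorem c06_seg_all :
    FSegOK (splineDensity (1/4) (3/5) (-16) 1 1 pieces) [1] (2 ^ 60) (panelLeft 1 0) (panelLeft 1 16) (-48908868413030400) (-48908868100554752) := by
  have h := c06_seg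
  norm_num at h
  exact h

/-- THE `[-16, 16]` TRIAL FUNCTION IS A WITNESS AT `(1/4, 3/5)`: `UnstableWitness 1/4 (3/5) (-16) 16 X X′`, `2⁶⁰·W ≤ -48908868100554752` (`W ≈ -0.0424`;
enclosure `[-0.0424217, -0.0424217]`). [cite: Freidberg2014, §12.3 eqs. (12.38)–(12.40)] -/
theorem unstableWitness_06 :
    UnstableWitness (1/4) (3/5) (-16) 16 (trialX 1 1 pieces (-16)) (trialX' 1 1 pieces (-16)) := by
  have h := unstableWitness_of_spline (s := 1/4) (α := 3/5) (a := -16) (h := 1) (m := 1) (ps := pieces)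
    one_pos one_pos pieces_ne_nil pieces_match pieces_deriv_match head_zero last_zero c06_seg_all (by decide)
  rw [pieces_length] at h
  norm_num at h
  exact h

/-- THE GLUED SEGMENT at `α = 11/10` in summed form. [cite: MahboubiMelquiondSibutpinote2016, Sect. 3.3] -/
theorem c11_seg_all :
    FSegOK (splineDensity (1/4) (11/10) (-16) 1 1 pieces) [1] (2 ^ 60) (panelLeft 1 0) (panelLeft 1 16) (-8586499819831296) (-8586498800615424) := by
  have h := c11_seg
  norm_num at h
  exact h

/-- THE `[-16, 16]` TRIAL FUNCTION IS A WITNESS AT `(1/4, 11/10)`: `UnstableWitness 1/4 (11/10) (-16) 16 X X′`, `2⁶⁰·W ≤ -8586498800615424` (`W ≈ -0.0074`;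
enclosure `[-0.0074476, -0.0074476]`). [cite: Freidberg2014, §12.3 eqs. (12.38)–(12.40)] -/
theorem unstableWitness_11 :
    UnstableWitness (1/4) (11/10) (-16) 16 (trialX 1 1 pieces (-16)) (trialX' 1 1 pieces (-16)) := by
  have h := unstableWitness_of_spline (s := 1/4) (α := 11/10) (a := -16) (h := 1) (m := 1) (ps := pieces)
    one_pos one_pos pieces_ne_nil pieces_match pieces_deriv_match head_zero last_zero c11_seg_all (by decide)
  rw [pieces_length] at h
  norm_num at h
  exact h

/-- ★★ THE BAND: the `[-16, 16]` trial function is a witness at EVERY `α ∈ [3/5, 11/10]` (the energy of a fixed trial function is a convex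
quadratic polynomial in `α`): `U_{1/4} ⊇ [3/5, 11/10]`. [cite: Freidberg2014, §12.3 eqs. (12.38)–(12.40)] («… The plasma is unstable», for the band of the MODEL) -/
theorem unstableWitness_band :
    ∀ α ∈ Icc (3/5 : ℝ) (11/10), UnstableWitness (1/4) α (-16) 16 (trialX 1 1 pieces (-16)) (trialX' 1 1 pieces (-16)) :=
  unstableWitness_of_mem_Icc unstableWitness_06 unstableWitness_11

/-- … hence every point of the band carries SOME witness, [cite: Freidberg2014, §12.3 eqs. (12.38)–(12.40)] -/
theorem exists_unstableWitness_of_mem_band {α : ℝ} (hα : α ∈ Icc (3/5 : ℝ) (11/10)) :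
    ∃ a b : ℝ, ∃ X X' : ℝ → ℝ, UnstableWitness (1/4) α a b X X' :=
  ⟨_, _, _, _, unstableWitness_band α hα⟩

/-- … and none is on the stable side. [cite: Freidberg2014, §12.3 eq. (12.40)] -/
theorem not_stableSide_of_mem_band {α : ℝ} (hα : α ∈ Icc (3/5 : ℝ) (11/10)) : ¬ StableSide (1/4) α := by
  obtain ⟨a, b, X, X', hw⟩ := exists_unstableWitness_of_mem_band hα
  exact fun hs => hs a b X X' hw

end Summit.Ventures.FusionMHD.Bench.SAlphaS025W104
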